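import Summits.QuantumFields.BalabanUV.Beta.FP.ConstrainedGhostIRCoarse
import Summits.QuantumFields.BalabanUV.Beta.FP.BlockAveragedKernelScalar

/-!
# `BalabanUV.Beta.FP.ConstrainedGhostIRLetters` — road «FP» for binder row D1, row H′2-IR ∕ IR-4a (R-FP-21 (A2)): THE FREE-LEG BLOCK LETTERS
# (S), (S′), (S″) and the within-block oscillation (L1′) IN COARSE UNITS, from gan24-formalise-leaf-04's IR-1-GEN PART 4 `FP/BlockAveragedKernelScalar`
# and three pointwise letters of the free leg `G₀ = latticeGreen∕2`; hence (T0)∕(T1) of the ghost remainder under (H-CINV) with constants FREE of `N`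

HONEST DEPENDENCY (page 1, mandatory): continuum YM on T⁴ ⇐ BetaPertH ∧ nine spine estimates (0/9 proved); BetaPertH ⇐ (D1) ∧ (D4) ∧
CAP+tail; G-an2-4 gates asym, D1 and NE2/3/4.  HONEST FRAMING (cell contract, verbatim): «discharging `BetaPertH` makes Bałaban's UV
stability UNCONDITIONAL — a real constructive-QFT result; it is NOT the continuum limit and NOT the Clay problem.»  THIS MODULE is [folklore]
lattice bookkeeping: gan24-leaf-04's `abs_blockAvg_le_profile` ∕ `abs_blockAvg_fwdDiff_le_profile` ∕ `abs_blockAvg_fwdDiff₂_le_profile_marginal` (PART 4),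
`FP/LatticeTaylorPath.abs_taylor0D_le`, leaf-06's `FP/ConstrainedGhostIR` interface and leaf-05-g9's `FP/ConstrainedGhostIRCoarse` BY NAME, plus two
integer-arithmetic lemmas on block indices; no `def`, no `def … : Prop`, nothing cited, 0 sorry.  DISPLAYED HYPOTHESES with suppliers: the
pointwise free-leg letters (G0) `|G₀ z| ≤ C₀∕(‖z‖∞+1)²`, (G1) `|G₀(z+e_i) − G₀ z| ≤ C₁∕(‖z‖∞+1)³`, (G2) second differences `≤ C₂∕(‖z‖∞+1)⁴`
[`TwoPowerLegs.free`∕`free_sharp` + `LatticeGreenAsymptotics`, gan24-leaf-04's PART 5 ∕ leaf-06's junction — not restated here], and (H-CINV)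
[owner∕leaf-06 IR-4b `FP/CoarseInverseScalar`].  0∕4 binders of row D1; NOT D1, NOT BetaPertH, NOT continuum, NOT Clay.

ABSOLUTE RULE (cell charter, verbatim): «No internally-minted statement may enter as a cited fact. Every hypothesis is either kernel-proved in
this package or a verbatim quotation of a PUBLISHED theorem with page reference. The manuscript(s) under audit are NOT citable for their own
disputed steps — they are the thing under adjudication; programme-internal (2001/route/tribunal) claims are never citable.»

CONTENT. §1 block-index arithmetic: `red_bounds`, **`coarse_le`** (`N·(‖quo N x − u‖∞+1) ≤ 2·(N+1+‖x − N•u‖∞)`), **`supNorm_quo_sub_quo_le_one`**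
(block indices are 1-Lipschitz at scale N), `inv_pow_fine_le_coarse`; §2 the letters in leaf-06's φ-format: **`letterS`** (`|blockSum N (G₀(x−·)) y| ≤
(3²·4·104977·C₀)·N²·φ₂(y − quo N x)`), **`letterS'`** (`≤ (3³·8·104977·C₁)·N·φ₃`), **`letterS''`** (the marginal second difference, constant
`81·16·(16(97+64·log 3N)+1)·C₂` — the block-edge logarithm, R-FP-20), **`letterOsc`** ((L1′): `quo x = quo y ⟹ |A(x,v) − A(y,v)| ≤
(4·3³·8·8·104977·C₁)·N²∕(‖quo x − v‖∞+1)³`, coordinate-path telescoping INSIDE the scale-N box); §3 **`abs_ghostRem_le_of_legs`** ∕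
**`abs_ghostRem_sub_le_of_legs`**: (T0)∕(T1) under (G0)∕(G1) + (H-CINV) only, constants displayed and FREE of N at `κ = c₀N⁻⁶`.
Provenance: D1 formalisation swarm, unit b2b-balaban-beta-d1-formalise-leaf-05 gen 9 (prover-b2b-balaban-beta-d1-formalise-leaf-05-g9-0),
2026-08-20; `LEAVES-FP.md` row H′2-IR ∕ IR-4a.  [folklore], 0 def, 0 cite, 0 sorry.
-/

namespace Summit.QuantumFields.BalabanUV.Beta.FP.ConstrainedGhostIRLetters

open Finset fwdDiff
open scoped BigOperators
open Literature.Probability.LatticeModels (latticeGreen)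
open Literature.MathematicalPhysics.QuantumFieldTheory.LatticeForm (quo red red_add_smul_quo red_mem_box)
open Literature.MathematicalPhysics.QuantumFieldTheory.Balaban1983to89.Beta
open AffineAveraging (box toSite blockSum unitVec)
open ScalarBlockKKT (Ws)
open Literature.MathematicalPhysics.QuantumFieldTheory.Balaban1983to89.Beta.DyadicShell (Pt supNorm natAbs_le_supNorm exists_eq_supNorm
  supNorm_le_iff natAbs_le_iff_mem supNorm_eq_zero_iff)
open Literature.MathematicalPhysics.QuantumFieldTheory.Balaban1983to89.Beta.GradedBubbles (supNorm_neg)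
open Summit.QuantumFields.BalabanUV.Beta.FP.LatticeConvolutionBounds (one_le_supNorm_add_one nonneg_of_abs_le_div)
open Summit.QuantumFields.BalabanUV.Beta.FP.LatticeTaylorPath (abs_taylor0D_le)
open Summit.QuantumFields.BalabanUV.Beta.FP.BlockAveragedKernel (letter_nonneg_of_le supNorm_le_supNorm_sub_add)
open Summit.QuantumFields.BalabanUV.Beta.FP.BlockAveragedKernelScalar (abs_blockAvg_le_profile abs_blockAvg_fwdDiff_le_profile
  abs_blockAvg_fwdDiff₂_le_profile_marginal)
open Summit.QuantumFields.BalabanUV.Beta.FP.ConstrainedGhost (ghostRem)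
open Summit.QuantumFields.BalabanUV.Beta.FP.ConstrainedGhostIRCoarse (abs_ghostRem_le_of_coarseInv abs_ghostRem_sub_le_of_coarseInv)

/-! ## §1 Block-index arithmetic -/

/-- [folklore] Coordinates of the remainder `red N x` lie in `[0, N)`. -/
theorem red_bounds {N : ℕ} (hN : 0 < N) (x : Pt) (i : Fin 4) : 0 ≤ red N x i ∧ red N x i < N := by
  have h := red_mem_box hN x
  simp only [Literature.MathematicalPhysics.QuantumFieldTheory.LatticeForm.box, Fintype.mem_piFinset, Finset.mem_Ico] at h
  exact h i

/-- [folklore] **COARSE CONVERSION**: `N·(‖quo N x − u‖∞ + 1) ≤ 2·(N + 1 + ‖x − N•u‖∞)` — a fine-lattice profile at scale `N` around the block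
`N•u` dominates the coarse profile in the block index. -/
theorem coarse_le {N : ℕ} (hN : 1 ≤ N) (x u : Pt) :
    (N : ℝ) * ((supNorm (quo N x - u) : ℝ) + 1) ≤ 2 * ((N : ℝ) + 1 + supNorm (x - (N : ℤ) • u)) := by
  obtain ⟨i, hi⟩ := exists_eq_supNorm (quo N x - u)
  have hx : x = red N x + (N : ℤ) • quo N x := (red_add_smul_quo N x).symm
  have hcoord : (x - (N : ℤ) • u) i = (N : ℤ) * (quo N x - u) i + red N x i := by
    have := congrArg (fun f : Pt => f i) hx
    simp only [Pi.add_apply, Pi.smul_apply, smul_eq_mul, Pi.sub_apply] at this ⊢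
    rw [this]; ring
  have hr := red_bounds (N := N) (by omega) x i
  have hsup : ((x - (N : ℤ) • u) i).natAbs ≤ supNorm (x - (N : ℤ) • u) := natAbs_le_supNorm _ i
  -- integer inequality: N * k ≤ |N k + r| + (N - 1) with k = |(quo x - u) i|
  set k : ℤ := (quo N x - u) i with hk
  have hkabs : ((supNorm (quo N x - u) : ℤ)) = |k| := by rw [← hi, Int.natCast_natAbs]
  have hS : ((supNorm (x - (N : ℤ) • u) : ℤ)) ≥ |(N : ℤ) * k + red N x i| := by
    rw [← hcoord, ← Int.natCast_natAbs]; exact_mod_cast hsup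
  have hNk : (N : ℤ) * |k| ≤ |(N : ℤ) * k + red N x i| + (N - 1) := by
    have h1 : |(N : ℤ) * k| ≤ |(N : ℤ) * k + red N x i| + |red N x i| := by
      have := abs_sub ((N : ℤ) * k + red N x i) (red N x i)
      rwa [add_sub_cancel_right] at this
    rw [abs_mul, abs_of_nonneg (by positivity : (0 : ℤ) ≤ N)] at h1
    have h2 : |red N x i| ≤ (N : ℤ) - 1 := by rw [abs_of_nonneg hr.1]; omega
    linarith
  -- case split on k = 0
  have key : (N : ℤ) * (|k| + 1) ≤ 2 * ((N : ℤ) + 1 + supNorm (x - (N : ℤ) • u)) := by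
    rcases eq_or_ne k 0 with h0 | h0
    · rw [h0, abs_zero, zero_add, mul_one]; nlinarith [Int.natCast_nonneg (supNorm (x - (N : ℤ) • u))]
    · have hk1 : 1 ≤ |k| := Int.one_le_abs h0
      nlinarith
  have : (N : ℝ) * ((supNorm (quo N x - u) : ℝ) + 1) = (((N : ℤ) * (|k| + 1) : ℤ) : ℝ) := by
    push_cast; rw [← Int.cast_natCast (supNorm (quo N x - u)), hkabs]; push_cast; ring
  rw [this]
  have : (2 : ℝ) * ((N : ℝ) + 1 + supNorm (x - (N : ℤ) • u)) = ((2 * ((N : ℤ) + 1 + supNorm (x - (N : ℤ) • u)) : ℤ) : ℝ) := by push_cast; ring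
  rw [this]
  exact_mod_cast key

/-- [folklore] **BLOCK INDICES ARE 1-LIPSCHITZ AT SCALE `N`**: `|x′ᵢ − xᵢ| ≤ N − 1` for all `i` ⟹ `‖quo N x′ − quo N x‖∞ ≤ 1`. -/
theorem supNorm_quo_sub_quo_le_one {N : ℕ} (hN : 1 ≤ N) {x x' : Pt} (h : ∀ i, |x' i - x i| ≤ (N : ℤ) - 1) :
    supNorm (quo N x' - quo N x) ≤ 1 := by
  rw [supNorm_le_iff]
  intro i
  have hx := congrArg (fun f : Pt => f i) (red_add_smul_quo N x)
  have hx' := congrArg (fun f : Pt => f i) (red_add_smul_quo N x')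
  simp only [Pi.add_apply, Pi.smul_apply, smul_eq_mul] at hx hx'
  have hr := red_bounds (N := N) (by omega) x i
  have hr' := red_bounds (N := N) (by omega) x' i
  have hi := h i
  have hq : (N : ℤ) * ((quo N x' - quo N x) i) = (x' i - x i) - (red N x' i - red N x i) := by
    simp only [Pi.sub_apply]; linarith
  -- |N * Δq| ≤ 2N - 2 < 2N ⟹ |Δq| ≤ 1
  have hb : |(N : ℤ) * ((quo N x' - quo N x) i)| < 2 * N := by
    rw [hq]
    have := abs_sub (x' i - x i) (red N x' i - red N x i)
    have h2 : |red N x' i - red N x i| ≤ (N : ℤ) - 1 := by rw [abs_le]; omega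
    linarith
  rw [abs_mul, abs_of_nonneg (by positivity : (0 : ℤ) ≤ N)] at hb
  have hle : |(quo N x' - quo N x) i| ≤ 1 := by
    by_contra hc
    rw [not_le] at hc
    have : (2 : ℤ) ≤ |(quo N x' - quo N x) i| := by omega
    nlinarith
  have h2 := abs_le.mp hle
  exact natAbs_le_iff_mem.mpr ⟨by push_cast; omega, by push_cast; omega⟩

/-- [folklore] **FINE ⟹ COARSE PROFILE**: `N^a∕(N+1+‖x − N•u‖∞)^a ≤ 2^a∕(‖quo N x − u‖∞+1)^a`. -/
theorem inv_pow_fine_le_coarse {N : ℕ} (hN : 1 ≤ N) (x u : Pt) (a : ℕ) :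
    (N : ℝ) ^ a / ((N : ℝ) + 1 + supNorm (x - (N : ℤ) • u)) ^ a ≤ 2 ^ a / ((supNorm (quo N x - u) : ℝ) + 1) ^ a := by
  have h := coarse_le hN x u
  have hN0 : (0 : ℝ) < N := by exact_mod_cast hN
  have hm : (0 : ℝ) < (supNorm (quo N x - u) : ℝ) + 1 := by positivity
  have hD : (0 : ℝ) < (N : ℝ) + 1 + supNorm (x - (N : ℤ) • u) := by positivity
  rw [div_le_div_iff₀ (by positivity) (by positivity), ← mul_pow, ← mul_pow]
  exact pow_le_pow_left₀ (by positivity) (by linarith) a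

/-! ## §2 The letters in coarse units -/

section Letters

variable {N : ℕ} [NeZero N]

omit [NeZero N] in
/-- [folklore] `(N:ℤ) • u = N • u` on `Pt` (PART 4 writes the ℕ-action). -/
theorem zsmul_natCast_eq_nsmul (u : Pt) : ((N : ℤ)) • u = N • u := natCast_zsmul u N

omit [NeZero N] in
/-- [folklore] **(S) THE FREE-LEG BLOCK COLUMN**: `|blockSum N (G₀(x−·)) y| ≤ (36·104977·C₀)·N²·φ₂(y − quo N x)` from PART 4's profile (`a = 2`) and (G0). -/
theorem letterS (hN : 1 ≤ N) {C₀ : ℝ} (hG0 : ∀ z : Pt, |latticeGreen z / 2| ≤ C₀ / ((supNorm z : ℝ) + 1) ^ 2) (x y : Pt) :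
    |blockSum N (fun z => latticeGreen (x - z) / 2) y| ≤ (36 * 104977 * C₀) * (N : ℝ) ^ 2 * (((supNorm (y - quo N x) : ℝ) + 1) ^ 2)⁻¹ := by
  have hN0 : (0 : ℝ) < N := by exact_mod_cast hN
  have hN4 : (0 : ℝ) < (N : ℝ) ^ 4 := by positivity
  have hC : 0 ≤ C₀ := letter_nonneg_of_le hG0
  have h := abs_blockAvg_le_profile (P := fun z => latticeGreen z / 2) (a := 2) (by norm_num) hG0 hN x y
  rw [abs_mul, abs_of_pos (inv_pos.mpr hN4), ← div_eq_inv_mul, div_le_iff₀ hN4] at h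
  have hconv := inv_pow_fine_le_coarse hN x y 2
  rw [zsmul_natCast_eq_nsmul] at hconv
  rw [← supNorm_neg, neg_sub]
  have hD : (0 : ℝ) < ((N : ℝ) + 1 + supNorm (x - N • y)) ^ 2 := by positivity
  calc |blockSum N (fun z => latticeGreen (x - z) / 2) y|
      ≤ 3 ^ 2 * 104977 * C₀ / ((N : ℝ) + 1 + supNorm (x - N • y)) ^ 2 * (N : ℝ) ^ 4 := h
    _ = (3 ^ 2 * 104977 * C₀ * (N : ℝ) ^ 2) * ((N : ℝ) ^ 2 / ((N : ℝ) + 1 + supNorm (x - N • y)) ^ 2) := by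
        field_simp
    _ ≤ (3 ^ 2 * 104977 * C₀ * (N : ℝ) ^ 2) * (2 ^ 2 / ((supNorm (quo N x - y) : ℝ) + 1) ^ 2) :=
        mul_le_mul_of_nonneg_left hconv (by positivity)
    _ = (36 * 104977 * C₀) * (N : ℝ) ^ 2 * (((supNorm (quo N x - y) : ℝ) + 1) ^ 2)⁻¹ := by ring

omit [NeZero N] in
/-- [folklore] **(S′) THE DIFFERENCE COLUMN**: `|blockSum N (G₀(x+e_i−·)) y − blockSum N (G₀(x−·)) y| ≤ (216·104977·C₁)·N·φ₃(y − quo N x)` from PART 4 (`a+1 = 3`) and (G1). -/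
theorem letterS' (hN : 1 ≤ N) {C₁ : ℝ} (i : Fin 4)
    (hG1 : ∀ z : Pt, |latticeGreen (z + Pi.single i 1) / 2 - latticeGreen z / 2| ≤ C₁ / ((supNorm z : ℝ) + 1) ^ 3) (x y : Pt) :
    |blockSum N (fun z => latticeGreen (x + unitVec i - z) / 2) y - blockSum N (fun z => latticeGreen (x - z) / 2) y|
      ≤ (216 * 104977 * C₁) * (N : ℝ) * (((supNorm (y - quo N x) : ℝ) + 1) ^ 3)⁻¹ := by
  have hN0 : (0 : ℝ) < N := by exact_mod_cast hN
  have hN4 : (0 : ℝ) < (N : ℝ) ^ 4 := by positivity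
  have hC : 0 ≤ C₁ := letter_nonneg_of_le hG1
  have h := abs_blockAvg_fwdDiff_le_profile (P := fun z => latticeGreen z / 2) (a := 2) (by norm_num) i hG1 hN x y
  rw [← mul_sub, abs_mul, abs_of_pos (inv_pos.mpr hN4), ← div_eq_inv_mul, div_le_iff₀ hN4] at h
  have hconv := inv_pow_fine_le_coarse hN x y 3
  rw [zsmul_natCast_eq_nsmul] at hconv
  rw [← supNorm_neg, neg_sub]
  have e : (unitVec i : Pt) = Pi.single i 1 := rfl
  rw [e]
  calc |blockSum N (fun z => latticeGreen (x + Pi.single i 1 - z) / 2) y - blockSum N (fun z => latticeGreen (x - z) / 2) y|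
      ≤ 3 ^ (2 + 1) * 104977 * C₁ / ((N : ℝ) + 1 + supNorm (x - N • y)) ^ (2 + 1) * (N : ℝ) ^ 4 := h
    _ = (3 ^ 3 * 104977 * C₁ * (N : ℝ)) * ((N : ℝ) ^ 3 / ((N : ℝ) + 1 + supNorm (x - N • y)) ^ 3) := by
        field_simp
        ring
    _ ≤ (3 ^ 3 * 104977 * C₁ * (N : ℝ)) * (2 ^ 3 / ((supNorm (quo N x - y) : ℝ) + 1) ^ 3) :=
        mul_le_mul_of_nonneg_left hconv (by positivity)
    _ = (216 * 104977 * C₁) * (N : ℝ) * (((supNorm (quo N x - y) : ℝ) + 1) ^ 3)⁻¹ := by ring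

omit [NeZero N] in
/-- [folklore] **(L1′) THE WITHIN-BLOCK OSCILLATION**: for `x, y` in the same block (`quo N x = quo N y`),
`|blockSum N (G₀(x−·)) v − blockSum N (G₀(y−·)) v| ≤ (6912·104977·C₁)·N²∕(‖quo N x − v‖∞+1)³` — coordinate-path telescoping of (S′) INSIDE the radius-`(N−1)`
box around `x` (`LatticeTaylorPath.abs_taylor0D_le`), where block indices move by at most one (`supNorm_quo_sub_quo_le_one`). -/
theorem letterOsc (hN : 1 ≤ N) {C₁ : ℝ}
    (hG1 : ∀ (i : Fin 4) (z : Pt), |latticeGreen (z + Pi.single i 1) / 2 - latticeGreen z / 2| ≤ C₁ / ((supNorm z : ℝ) + 1) ^ 3)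
    (x y v : Pt) (hxy : quo N x = quo N y) :
    |blockSum N (fun z => latticeGreen (x - z) / 2) v - blockSum N (fun z => latticeGreen (y - z) / 2) v|
      ≤ (6912 * 104977 * C₁) * (N : ℝ) ^ 2 / ((supNorm (quo N x - v) : ℝ) + 1) ^ 3 := by
  have hN0 : (0 : ℝ) < N := by exact_mod_cast hN
  have hC : 0 ≤ C₁ := letter_nonneg_of_le (hG1 0)
  set m : ℝ := (supNorm (quo N x - v) : ℝ) + 1 with hm
  have hm1 : 1 ≤ m := one_le_supNorm_add_one _
  -- the step `s := y − x` stays inside the block: `|s i| ≤ N − 1`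
  have hs : ∀ i, |(y - x) i| ≤ ((N - 1 : ℕ) : ℤ) := by
    intro i
    have hx := congrArg (fun f : Pt => f i) (red_add_smul_quo N x)
    have hy := congrArg (fun f : Pt => f i) (red_add_smul_quo N y)
    simp only [Pi.add_apply, Pi.smul_apply, smul_eq_mul] at hx hy
    have hrx := red_bounds (N := N) (by omega) x i
    have hry := red_bounds (N := N) (by omega) y i
    have hq : quo N x i = quo N y i := by rw [hxy]
    have e : (y - x) i = red N y i - red N x i := by simp only [Pi.sub_apply]; rw [← hx, ← hy, hq]; ring
    rw [e, abs_le]; omega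
  -- the uniform step bound on the box
  set B : ℝ := (216 * 104977 * C₁) * (N : ℝ) * (8 / m ^ 3) with hB
  have hBnn : 0 ≤ B := by positivity
  have hstep : ∀ x'' : Pt, (∀ i, |x'' i - x i| ≤ ((N - 1 : ℕ) : ℤ)) →
      ∀ i : Fin 4, |Δ_[Pi.single i 1] (fun p => blockSum N (fun z => latticeGreen (p - z) / 2) v) x''| ≤ B := by
    intro x'' hx'' i
    rw [fwdDiff]
    have h1 := letterS' (N := N) hN i (hG1 i) x'' v
    have e : (unitVec i : Pt) = Pi.single i 1 := rfl
    rw [e] at h1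
    refine h1.trans ?_
    -- `‖quo x − v‖ + 1 ≤ 2 (‖quo x'' − v‖ + 1)`
    have hq1 : supNorm (quo N x'' - quo N x) ≤ 1 :=
      supNorm_quo_sub_quo_le_one hN (fun j => by have := hx'' j; omega)
    have htri : (supNorm (quo N x - v) : ℝ) ≤ 1 + supNorm (v - quo N x'') := by
      have h := supNorm_le_supNorm_sub_add (quo N x - v) (quo N x'' - v)
      have e2 : quo N x - v - (quo N x'' - v) = -(quo N x'' - quo N x) := by abel
      rw [e2, supNorm_neg] at h
      have e3 : supNorm (quo N x'' - v) = supNorm (v - quo N x'') := by rw [← supNorm_neg, neg_sub]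
      rw [e3] at h
      have : (supNorm (quo N x - v) : ℝ) ≤ supNorm (quo N x'' - quo N x) + supNorm (v - quo N x'') := by exact_mod_cast h
      have h1' : (supNorm (quo N x'' - quo N x) : ℝ) ≤ 1 := by exact_mod_cast hq1
      linarith
    have hm'' : 0 < (supNorm (v - quo N x'') : ℝ) + 1 := by positivity
    have hkey : (((supNorm (v - quo N x'') : ℝ) + 1) ^ 3)⁻¹ ≤ 8 / m ^ 3 := by
      rw [inv_eq_one_div, div_le_div_iff₀ (by positivity) (by positivity), one_mul]
      have : m ≤ 2 * ((supNorm (v - quo N x'') : ℝ) + 1) := by rw [hm]; linarith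
      calc m ^ 3 ≤ (2 * ((supNorm (v - quo N x'') : ℝ) + 1)) ^ 3 := pow_le_pow_left₀ (by linarith) this 3
        _ = 8 * ((supNorm (v - quo N x'') : ℝ) + 1) ^ 3 := by ring
    calc (216 * 104977 * C₁) * (N : ℝ) * (((supNorm (v - quo N x'') : ℝ) + 1) ^ 3)⁻¹
        ≤ (216 * 104977 * C₁) * (N : ℝ) * (8 / m ^ 3) := mul_le_mul_of_nonneg_left hkey (by positivity)
      _ = B := by rw [hB]
  have h := abs_taylor0D_le (fun p => blockSum N (fun z => latticeGreen (p - z) / 2) v) x (y - x) hs hBnn hstep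
  rw [add_sub_cancel] at h
  rw [abs_sub_comm]
  refine h.trans ?_
  have hN1 : (((N - 1 : ℕ) : ℕ) : ℝ) ≤ (N : ℝ) := by exact_mod_cast Nat.sub_le N 1
  calc (4 : ℝ) * (((N - 1 : ℕ)) : ℝ) * B ≤ 4 * (N : ℝ) * B := by gcongr
    _ = (6912 * 104977 * C₁) * (N : ℝ) ^ 2 / m ^ 3 := by rw [hB]; field_simp; ring

omit [NeZero N] in
/-- [folklore] **(S″) THE MARGINAL SECOND-DIFFERENCE COLUMN** (R-FP-20: carries the block-edge `log N`):
`|A(x+e_μ+e_ν,y) − A(x+e_μ,y) − A(x+e_ν,y) + A(x,y)| ≤ (1296·(16(97+64·log 3N)+1)·C₂)·φ₄(y − quo N x)`. -/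
theorem letterS'' (hN : 1 ≤ N) {C₂ : ℝ} (μ ν : Fin 4)
    (hG2 : ∀ z : Pt, |latticeGreen (z + Pi.single μ 1 + Pi.single ν 1) / 2 - latticeGreen (z + Pi.single μ 1) / 2
        - latticeGreen (z + Pi.single ν 1) / 2 + latticeGreen z / 2| ≤ C₂ / ((supNorm z : ℝ) + 1) ^ 4) (x y : Pt) :
    |blockSum N (fun z => latticeGreen (x + unitVec μ + unitVec ν - z) / 2) y - blockSum N (fun z => latticeGreen (x + unitVec μ - z) / 2) y
        - blockSum N (fun z => latticeGreen (x + unitVec ν - z) / 2) y + blockSum N (fun z => latticeGreen (x - z) / 2) y|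
      ≤ (1296 * (16 * (97 + 64 * Real.log ((3 * N : ℕ) : ℝ)) + 1) * C₂) * (((supNorm (y - quo N x) : ℝ) + 1) ^ 4)⁻¹ := by
  have hN0 : (0 : ℝ) < N := by exact_mod_cast hN
  have hN4 : (0 : ℝ) < (N : ℝ) ^ 4 := by positivity
  have hC : 0 ≤ C₂ := letter_nonneg_of_le hG2
  have hlog : 0 ≤ Real.log ((3 * N : ℕ) : ℝ) := Real.log_nonneg (by exact_mod_cast (by omega : 1 ≤ 3 * N))
  have h := abs_blockAvg_fwdDiff₂_le_profile_marginal (P := fun z => latticeGreen z / 2) μ ν hG2 hN x y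
  rw [← mul_sub, ← mul_sub, ← mul_add, abs_mul, abs_of_pos (inv_pos.mpr hN4), ← div_eq_inv_mul, div_le_iff₀ hN4] at h
  have hconv := inv_pow_fine_le_coarse hN x y 4
  rw [zsmul_natCast_eq_nsmul] at hconv
  rw [← supNorm_neg, neg_sub]
  have e1 : (unitVec μ : Pt) = Pi.single μ 1 := rfl
  have e2 : (unitVec ν : Pt) = Pi.single ν 1 := rfl
  rw [e1, e2]
  set L : ℝ := 16 * (97 + 64 * Real.log ((3 * N : ℕ) : ℝ)) + 1 with hL
  have hLnn : 0 ≤ L := by positivity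
  calc |blockSum N (fun z => latticeGreen (x + Pi.single μ 1 + Pi.single ν 1 - z) / 2) y
          - blockSum N (fun z => latticeGreen (x + Pi.single μ 1 - z) / 2) y
          - blockSum N (fun z => latticeGreen (x + Pi.single ν 1 - z) / 2) y + blockSum N (fun z => latticeGreen (x - z) / 2) y|
      ≤ 81 * L * C₂ / ((N : ℝ) + 1 + supNorm (x - N • y)) ^ 4 * (N : ℝ) ^ 4 := h
    _ = (81 * L * C₂) * ((N : ℝ) ^ 4 / ((N : ℝ) + 1 + supNorm (x - N • y)) ^ 4) := by
        field_simp
    _ ≤ (81 * L * C₂) * (2 ^ 4 / ((supNorm (quo N x - y) : ℝ) + 1) ^ 4) := mul_le_mul_of_nonneg_left hconv (by positivity)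
    _ = (1296 * L * C₂) * (((supNorm (quo N x - y) : ℝ) + 1) ^ 4)⁻¹ := by ring

/-! ## §3 (T0)∕(T1) under the pointwise free-leg letters and (H-CINV) -/

/-- [folklore] **(T0) FROM (G0), (G1), (H-CINV)**: `|ghostRem N x x′| ≤ 162·(36·104977·C₀)·(1296·κ·(6912·104977·C₁)·N⁶ + 1)·(N²)⁻¹` for ALL `x, x′`
(with IR-4b's `κ = c₀N⁻⁶` the constant is FREE of `N`). -/
theorem abs_ghostRem_le_of_legs (C : Pt → Pt → ℝ) {κ C₀ C₁ : ℝ} (hN : 1 ≤ N)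
    (hC : ∀ u v, |C u v| ≤ κ / ((supNorm (u - v) : ℝ) + 1) ^ 5)
    (hCM : ∀ u w, HasSum (fun v => C u v * ∑ b ∈ box (3 + 1) N, blockSum N (fun z => latticeGreen ((N : ℤ) • v + toSite b - z) / 2) w)
      (if u = w then 1 else 0))
    (hG0 : ∀ z : Pt, |latticeGreen z / 2| ≤ C₀ / ((supNorm z : ℝ) + 1) ^ 2)
    (hG1 : ∀ (i : Fin 4) (z : Pt), |latticeGreen (z + Pi.single i 1) / 2 - latticeGreen z / 2| ≤ C₁ / ((supNorm z : ℝ) + 1) ^ 3)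
    (x x' : Pt) :
    |ghostRem (d := 3) N x x'| ≤ 162 * (36 * 104977 * C₀) * (1296 * κ * (6912 * 104977 * C₁) * (N : ℝ) ^ 6 + 1) * ((N : ℝ) ^ 2)⁻¹ :=
  abs_ghostRem_le_of_coarseInv C hN hC hCM (fun a b v hab => letterOsc hN hG1 a b v hab) (letterS hN hG0) x x'

/-- [folklore] **(T1) FROM (G1), (H-CINV)**: `|ghostRem N (x+e_i) x′ − ghostRem N x x′| ≤ 162·(216·104977·C₁)·(1296·κ·(6912·104977·C₁)·N⁶ + 1)·(N³)⁻¹`. -/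
theorem abs_ghostRem_sub_le_of_legs (C : Pt → Pt → ℝ) {κ C₁ : ℝ} (hN : 1 ≤ N)
    (hC : ∀ u v, |C u v| ≤ κ / ((supNorm (u - v) : ℝ) + 1) ^ 5)
    (hCM : ∀ u w, HasSum (fun v => C u v * ∑ b ∈ box (3 + 1) N, blockSum N (fun z => latticeGreen ((N : ℤ) • v + toSite b - z) / 2) w)
      (if u = w then 1 else 0))
    (hG1 : ∀ (i : Fin 4) (z : Pt), |latticeGreen (z + Pi.single i 1) / 2 - latticeGreen z / 2| ≤ C₁ / ((supNorm z : ℝ) + 1) ^ 3)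
    (i : Fin 4) (x x' : Pt) :
    |ghostRem (d := 3) N (x + unitVec i) x' - ghostRem (d := 3) N x x'|
      ≤ 162 * (216 * 104977 * C₁) * (1296 * κ * (6912 * 104977 * C₁) * (N : ℝ) ^ 6 + 1) * ((N : ℝ) ^ 3)⁻¹ :=
  abs_ghostRem_sub_le_of_coarseInv C hN hC hCM (fun a b v hab => letterOsc hN hG1 a b v hab) (unitVec i) (letterS' hN i (hG1 i)) x x'

end Letters

end Summit.QuantumFields.BalabanUV.Beta.FP.ConstrainedGhostIRLetters
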